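import Mathlib
import Literature.AlgebraicGeometry.HodgeTheory.FermatShiodaCondition
import Summits.HodgeConjecture.FermatCycles.HodgeFermatPropDPrimeNFinal
import Summits.HodgeConjecture.FermatCycles.HodgeFermatTheoremB2Statement

/-!
# THEOREM B2 — Aoki–Shioda's `(𝔅²_N)(i)` at every squarefree level `N` prime to `6`, from THEOREM KR6 (`HodgeFermat/TheoremB2.lean` + `TheoremB2Final.lean`; HF-G28b); closes the statement `B2`

Tree copy of 2 modules of the sibling cell's standalone package `run/shared/lean/pub/pub-hodgefermat/lean/HodgeFermat/`,
concatenated IN DEPENDENCY ORDER in one tree file (each module's body byte-identical to its source lines, its own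
`namespace … end` block kept; the precedent is `HodgeFermatPropDPrimeNFinal.lean`):
  1. `HodgeFermat/TheoremB2.lean` (204 lines, sha256 `9b7a84ad3bbd49d6…`), source lines 39–44 and 66–204 (the bridge
     `sameType_of_hodge4` with its five small `ZMod`/`Multiset` lemmas, `b2_of_kr6 : KR6Multiset' → B2`, the Aoki–Shioda wording
     `decomposable_of_twoPairs`, `twoPairs_card`, and the two `example`s showing that `3 ∤ N` cannot be dropped) — pub-hodgefermat
     `CERT.md` l.930, GATE HF-G28b; cell record `check/B2_standalone.lean` (hub `lean check` rc 0, `--axioms …b2_of_kr6` = the trio);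
  2. `HodgeFermat/TheoremB2Final.lean` (46 lines, sha256 `6109533091f23973…`), source lines 23–27 and 32–46 (`b2 : B2`, `b2At`,
     `decomposableAt` — THEOREM B2 unconditionally) — GATE HF-G28b; cell record the link check `check/B2Link_standalone.lean`
     (`--axioms HodgeFermat.KRFree.TheoremB2.b2` = the trio + exactly the postulated `TheoremKR.kr6Multiset`, itself certified
     by `check/KR6_standalone.lean` + `check/KR6Link_standalone.lean`, GATE HF-G28 — and a THEOREM of this tree since 2026-08-26,
     `HodgeFermat.KRFree.TheoremKR.kr6Multiset` in `HodgeFermatPropDPrimeNFinal.lean`).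
Filed by cell `pub-hfermat`, seat prover-1 gen-5, on the COORDINATOR KEEPER RULING of 2026-08-25 (gem sweep H1: take the
off-gate kernel theorem `thmFstar` through the gate).  Every form of THEOREM F* of the sibling package is on-gate since
2026-08-25/26 (`HodgeFermatThmFstar.lean` = F*(3p), HF-G32, seat gen-0; `HodgeFermatThmFstarN.lean` = F*(3N), HF-G33, gen-2;
`HodgeFermatPropDPrimeNFinal.lean` = PROPOSITION D′(3N) + THE DESCENT, HF-G34, gen-3; `HodgeFermatDPrimePrime.lean` = D′(3p),
HF-G32, and `HodgeFermatDescentBFinal.lean` = the descent at 15N/21N, HF-G34b, gen-4); this generation files, by the same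
verbatim-port protocol, the sibling's remaining off-gate named gate theorems nearest to that chain: THEOREM B2 (HF-G28b),
the unconditional final forms of LEMMA E / THEOREM (μ even) / (ν odd) / (Σν) at prime levels (HF-G31c/d/e), COROLLARY M
with its seventh clause (HF-G31) and THEOREM U⁼ with the list of exceptions in no-binder form (HF-G27d).
Deviations from the source modules, exhaustively: the `import` lines (`Mathlib`; the tree's
`Literature.AlgebraicGeometry.HodgeTheory.FermatShiodaCondition` for the vendored copy `HodgeFermat.Vendored.FermatShiodaCondition`
— the vendored file is byte-for-byte that tree file, sha256 `8f58f8d64694…`, namespaces unchanged —; `…HodgeFermatPropDPrimeNFinal` for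
`import HodgeFermat.TheoremKRFinal` (THEOREM KR6 `kr6Multiset` landed there) and, through it, for `import HodgeFermat.LemmaN`
(`InH`/`SameType`, landed in `HodgeFermatThmFstarStatement.lean`); `…HodgeFermatTheoremB2Statement` for the two definitions
`TwoPairs`, `B2` filed first (source l.56–64, NOT re-declared here); module 2's `import HodgeFermat.TheoremB2` points inside this
file); this docstring (replacing the modules' docstrings, both quoted below); TWO DEDUP deletions re-bound so that every use site
stays byte-identical: module 1's `def KR6Multiset'` (source l.46–54, by its own docstring a «verbatim copy of
`HodgeFermat.KRFree.TheoremKR.KR6Multiset`», landed in `HodgeFermatTheoremKRA.lean`) and module 2's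
`theorem kr6Multiset' : KR6Multiset' := TheoremKR.kr6Multiset` (source l.29–30, statement and content the landed
`HodgeFermat.KRFree.TheoremKR.kr6Multiset`) are NOT re-declared — both names are brought into scope by
`open HodgeFermat.KRFree.TheoremKR renaming KR6Multiset → KR6Multiset', kr6Multiset → kr6Multiset'` at the top of each block.
Every other line — in particular every declaration's statement and proof, `b2_of_kr6 (hK : KR6Multiset') : B2` and
`b2 : B2 := b2_of_kr6 kr6Multiset'` included — is byte-identical to its source.
Trust base: no hypotheses in `b2`, no `sorry`; `decide` only in the two source `example`s at level `15`;
axioms = [propext, Classical.choice, Quot.sound].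
HONEST FRAMING: explicit algebraic cycles for specific Hodge classes on Fermat/Delsarte varieties; residual open instances
listed; no claim on general Hodge.  (This file is arithmetic of CM types / finite combinatorics of the sibling's KR-free
programme; it claims nothing about cycles.)

(1) The docstring of `HodgeFermat/TheoremB2.lean` (l.7–37), verbatim:

## THEOREM B2 — Aoki–Shioda's `(𝔅²_m)(i)` at the squarefree levels prime to `6`, from THEOREM KR6 (HF-G28b)

Aoki–Shioda [AokiShioda1983, Theorem (𝔅²_m)(i); `tables/LAMBDA-THEOREM.md` §4.2]: *if `(m, 6) = 1`, every Hodge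
quadruple `(a₀, a₁, a₂, a₃) ∈ 𝔅²_m` is decomposable — `aᵢ + aⱼ ≡ 0 (mod m)` for some `i ≠ j`*, i.e. (the sum being
`0`) it is a sum of two pairs `{a, −a} + {b, −b}`.  This is the input of THEOREM H4 and, through it, of every
"imports Aoki–Shioda" line of `tables/KR-FREE.md`.  This module proves it **in the kernel at every SQUAREFREE level
`N` prime to `6`**, for Hodge multisets in the sense of the vendored `Literature` predicate `IsHodgeMultiset`
(all elements non-zero, sum `0`, Shioda length `2 · Σ⟨t a⟩ = N · #s` at every unit `t`), with NO unit hypothesis on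
the entries (generation 27's `CorollaryUPrimeFinal.quadruple_odd` needed all four entries to be units; here entries
divisible by primes of `N` are allowed) — from THEOREM KR6 in multiset form (`TheoremKRFinal.kr6Multiset`,
generation 28), which this LIGHT module takes as the hypothesis `KR6Multiset'` (a verbatim copy of
`TheoremKR.KR6Multiset`, so that the record of this module does not re-elaborate the THEOREM U chain; the final
module `TheoremB2Final.lean` discharges it definitionally, `kr6Multiset' := TheoremKR.kr6Multiset`).

THE BRIDGE (`sameType_of_hodge4`).  Let `s = {x, y, z, w}` be a Hodge multiset of level `N`.  If `x + y = 0` then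
`z + w = 0` and `s = {x, −x} + {z, −z}`.  Otherwise the two triples `T = (x, y, −(x+y))` and `T' = (−z, −w, −(x+y))`
(representatives `ZMod.val`) have zero sum and no entry `≡ 0`, and THE SAME CM TYPE: at a unit `t`, Shioda's length
condition reads `⟨tx⟩ + ⟨ty⟩ + ⟨tz⟩ + ⟨tw⟩ = 2N`, so `t ∈ H_T ⟺ ⟨tx⟩ + ⟨ty⟩ < N ⟺ ⟨tz⟩ + ⟨tw⟩ > N ⟺
(N − ⟨tz⟩) + (N − ⟨tw⟩) < N ⟺ t ∈ H_{T'}` (`⟨−v⟩ = N − ⟨v⟩` for `v ≢ 0`).  THEOREM KR6 (multiset form) gives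
`{x, y, −(x+y)} = {−z, −w, −(x+y)}` in `ℤ/N`, hence `{x, y} = {−z, −w}`, i.e. `s = {x, −x} + {y, −y}`.

SCOPE.  Squarefree `N` with `(N, 6) = 1` only — exactly the levels of THEOREM KR6.  The hypothesis `3 ∤ N` cannot be
dropped (`example` below: Shioda's `σ₃`-type quadruple `{1, 6, 11, 12}` of level `15` is a Hodge multiset and is not
two pairs); non-squarefree levels prime to `6` (`25, 35², …`) are Aoki–Shioda's theorem but not this module's.

Main declarations
* `KR6Multiset'` : verbatim copy of `TheoremKR.KR6Multiset` (the hypothesis of this light module);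
* `TwoPairs s` : `∃ a b, s = {a, −a, b, −b}`;  `B2` : the statement;  `b2_of_kr6 : KR6Multiset' → B2`;
* `sameType_of_hodge4` : the bridge;  `decomposable_of_twoPairs` : the Aoki–Shioda wording (`∃` two entries summing to `0`).

(2) The docstring of `HodgeFermat/TheoremB2Final.lean` (l.7–21), verbatim:

## THEOREM B2 — unconditional (HF-G28b)

`b2 : B2` — **at a squarefree level `N` prime to `6`, every Hodge multiset with four elements is a sum of two pairs
`{a, −a} + {b, −b}`** (Aoki–Shioda's `(𝔅²_N)(i)` at these levels, no unit hypothesis on the entries), with no imported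
input: `TheoremB2.b2_of_kr6 : KR6Multiset' → B2` (this generation's light module) applied to THEOREM KR6 in multiset
form, `TheoremKR.kr6Multiset` (generation 28: `TheoremKRFinal.lean`, i.e. `kr6_of_W` + LEMMA W `OneFile.hypW` of
generation 24) — `KR6Multiset'` is the verbatim copy of `TheoremKR.KR6Multiset`, so the two `Prop`s are definitionally
equal and the hypothesis is discharged by `kr6Multiset` itself.
Hub records: `check/B2_standalone.lean` (`LemmaN` + the four vendored `Literature` files + `TheoremB2`;
`--axioms …b2_of_kr6` = the three) and the link check `check/B2Link_standalone.lean` (the same bodies, the statement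
`TheoremKR.KR6Multiset` excerpted verbatim and `TheoremKR.kr6Multiset` POSTULATED with a citation of its generation-28
records `check/KR6_standalone.lean` + `check/KR6Link_standalone.lean`, then this module verbatim:
`--axioms HodgeFermat.KRFree.TheoremB2.b2` = the three + exactly `HodgeFermat.KRFree.TheoremKR.kr6Multiset`); `GATE.md` § HF-G28b.
-/

-- ════════════════════════════════════════════════════════════════════════════════════════════════
-- module 1/2: HodgeFermat/TheoremB2.lean (source lines 39–44, 66–204)
-- ════════════════════════════════════════════════════════════════════════════════════════════════

set_option autoImplicit false

namespace HodgeFermat.KRFree.TheoremB2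

open HodgeFermat.KRFree.LemmaN (InH SameType)
open Literature.AlgebraicGeometry.HodgeTheory.FermatCharacter (IsHodgeMultiset mNormSum)
open HodgeFermat.KRFree.TheoremKR renaming KR6Multiset → KR6Multiset', kr6Multiset → kr6Multiset'

-- `def KR6Multiset'` (source l.46–54, the verbatim copy of `TheoremKR.KR6Multiset`): NOT re-declared — it is the landed
-- `HodgeFermat.KRFree.TheoremKR.KR6Multiset` (`HodgeFermatTheoremKRA.lean`), renamed into scope above (DEDUP).
-- `def TwoPairs`, `def B2` (source l.56–64): filed first, `HodgeFermatTheoremB2Statement.lean` (same namespace).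

section Bridge

variable {N : ℕ}

/-- `⟨t · val x⟩_N = val (t • x)`. -/
lemma mul_val_mod (t : ℕ) (x : ZMod N) : t * x.val % N = ((t : ZMod N) * x).val := by
  rw [ZMod.val_mul, ZMod.val_natCast, Nat.mod_mul_mod]

/-- Shioda's length condition for a 4-element multiset at the unit `u`: `⟨ux⟩ + ⟨uy⟩ + ⟨uz⟩ + ⟨uw⟩ = 2N`. -/
lemma hodge4_length {x y z w : ZMod N} (hs : IsHodgeMultiset ({x, y, z, w} : Multiset (ZMod N)))
    (u : (ZMod N)ˣ) :
    ((u : ZMod N) * x).val + ((u : ZMod N) * y).val + ((u : ZMod N) * z).val + ((u : ZMod N) * w).val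
      = 2 * N := by
  have h := hs.2 u
  simp only [mNormSum, Multiset.insert_eq_cons, Multiset.map_cons, Multiset.map_singleton, Multiset.sum_cons,
    Multiset.sum_singleton, Multiset.card_cons, Multiset.card_singleton] at h
  omega

variable [NeZero N]

/-- `⟨−u⟩ = N − ⟨u⟩` for `u ≠ 0`. -/
lemma val_neg_of_ne_zero {u : ZMod N} (hu : u ≠ 0) : (-u).val = N - u.val := by
  rw [ZMod.neg_val, if_neg hu]

/-- `N ∣ val p + val q + val r` iff `p + q + r = 0`. -/
lemma dvd_val_add₃ {p q r : ZMod N} (h : p + q + r = 0) : N ∣ p.val + q.val + r.val := by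
  rw [← ZMod.natCast_eq_zero_iff]
  push_cast
  simpa only [ZMod.natCast_zmod_val] using h

/-- `N ∤ val p` for `p ≠ 0`. -/
lemma not_dvd_val {p : ZMod N} (hp : p ≠ 0) : ¬ N ∣ p.val := by
  intro h
  apply hp
  rw [← ZMod.natCast_zmod_val p, ZMod.natCast_eq_zero_iff]
  exact h

/-- **The bridge.**  For a Hodge multiset `{x, y, z, w}` (with `z, w ≠ 0`) the triples `(x, y, −(x+y))` and
`(−z, −w, −(x+y))` have the same CM type. -/
theorem sameType_of_hodge4 {x y z w : ZMod N} (hs : IsHodgeMultiset ({x, y, z, w} : Multiset (ZMod N)))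
    (hz : z ≠ 0) (hw : w ≠ 0) :
    SameType N (x.val, y.val, (-(x + y)).val) ((-z).val, (-w).val, (-(x + y)).val) := by
  intro t ht
  have hu : ((ZMod.unitOfCoprime t ht : (ZMod N)ˣ) : ZMod N) = t := ZMod.coe_unitOfCoprime t ht
  have hlen := hodge4_length hs (ZMod.unitOfCoprime t ht)
  rw [hu] at hlen
  have htu : IsUnit (t : ZMod N) := hu ▸ (ZMod.unitOfCoprime t ht).isUnit
  have htz : (t : ZMod N) * z ≠ 0 := fun h => hz (htu.mul_right_eq_zero.mp h)
  have htw : (t : ZMod N) * w ≠ 0 := fun h => hw (htu.mul_right_eq_zero.mp h)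
  show t * x.val % N + t * y.val % N < N ↔ t * (-z).val % N + t * (-w).val % N < N
  rw [mul_val_mod, mul_val_mod, mul_val_mod, mul_val_mod, mul_neg, mul_neg, val_neg_of_ne_zero htz,
    val_neg_of_ne_zero htw]
  have lz := ZMod.val_lt ((t : ZMod N) * z)
  have lw := ZMod.val_lt ((t : ZMod N) * w)
  constructor
  · intro h; omega
  · intro h; omega

end Bridge

/-- `{p, q, r} = r ::ₘ {p, q}` — rotating a three-element multiset literal. -/
lemma triple_rot {α : Type*} (p q r : α) : ({p, q, r} : Multiset α) = r ::ₘ p ::ₘ {q} := by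
  rw [Multiset.pair_comm q r]
  exact Multiset.cons_swap p r {q}

/-- **THEOREM B2 from THEOREM KR6.** -/
theorem b2_of_kr6 (hK : KR6Multiset') : B2 := by
  intro N hsq h2 h3 s hs h4
  obtain ⟨x, y, z, w, rfl⟩ := Multiset.card_eq_four.mp h4
  have hN0 : N ≠ 0 := by rintro rfl; exact not_squarefree_zero hsq
  haveI : NeZero N := ⟨hN0⟩
  have hx : x ≠ 0 := hs.1.1 x (by simp)
  have hy : y ≠ 0 := hs.1.1 y (by simp)
  have hz : z ≠ 0 := hs.1.1 z (by simp)
  have hw : w ≠ 0 := hs.1.1 w (by simp)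
  have hsum : x + (y + (z + w)) = 0 := by
    simpa only [Multiset.insert_eq_cons, Multiset.sum_cons, Multiset.sum_singleton] using hs.1.2
  by_cases hxy : x + y = 0
  · -- the quadruple splits along `{x, y}`: then `z + w = 0` too
    have hy' : y = -x := eq_neg_of_add_eq_zero_right hxy
    have hzw : z + w = 0 := by rw [← add_assoc, hxy, zero_add] at hsum; exact hsum
    have hw' : w = -z := eq_neg_of_add_eq_zero_right hzw
    exact ⟨x, z, by rw [hy', hw']⟩
  · -- the main case: THEOREM KR6 on `T = (x, y, −(x+y))`, `T' = (−z, −w, −(x+y))`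
    have hc : -(x + y) ≠ 0 := by rwa [ne_eq, neg_eq_zero]
    have key := hK N x.val y.val (-(x + y)).val (-z).val (-w).val (-(x + y)).val hsq h2 h3
      (dvd_val_add₃ (by ring)) (dvd_val_add₃ (by linear_combination -hsum))
      (not_dvd_val hx) (not_dvd_val hy) (not_dvd_val hc) (not_dvd_val (neg_ne_zero.mpr hz))
      (not_dvd_val (neg_ne_zero.mpr hw)) (not_dvd_val hc) (sameType_of_hodge4 hs hz hw)
    simp only [ZMod.natCast_zmod_val] at key
    -- `key : {x, y, −(x+y)} = {−z, −w, −(x+y)}`; cancel the common third entry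
    rw [triple_rot x y, triple_rot (-z) (-w)] at key
    have key2 : x ::ₘ ({y} : Multiset (ZMod N)) = (-z) ::ₘ {-w} := (Multiset.cons_inj_right _).mp key
    have hmem : x ∈ (-z) ::ₘ ({-w} : Multiset (ZMod N)) := key2 ▸ Multiset.mem_cons_self x {y}
    rcases Multiset.mem_cons.mp hmem with h1 | h1
    · -- `x = −z`, hence `y = −w`
      rw [h1] at key2
      have h2' : y = -w := Multiset.singleton_inj.mp ((Multiset.cons_inj_right _).mp key2)
      refine ⟨x, y, ?_⟩
      rw [show z = -x by rw [h1, neg_neg], show w = -y by rw [h2', neg_neg]]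
      show x ::ₘ y ::ₘ (-x) ::ₘ ({-y} : Multiset (ZMod N)) = x ::ₘ (-x) ::ₘ y ::ₘ {-y}
      rw [Multiset.cons_swap y (-x)]
    · -- `x = −w`, hence `y = −z`
      rw [Multiset.mem_singleton] at h1
      rw [h1] at key2
      have h2' : y = -z :=
        Multiset.singleton_inj.mp ((Multiset.cons_inj_right (-w)).mp (key2.trans (Multiset.pair_comm (-z) (-w))))
      refine ⟨x, y, ?_⟩
      rw [show z = -y by rw [h2', neg_neg], show w = -x by rw [h1, neg_neg], Multiset.pair_comm (-y) (-x)]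
      show x ::ₘ y ::ₘ (-x) ::ₘ ({-y} : Multiset (ZMod N)) = x ::ₘ (-x) ::ₘ y ::ₘ {-y}
      rw [Multiset.cons_swap y (-x)]

/-! ## The Aoki–Shioda wording and the necessity of `3 ∤ N` -/

/-- a sum of two pairs is *decomposable* in Aoki–Shioda's sense: two of its entries (counted with multiplicity,
i.e. `a ::ₘ b ::ₘ _ ≤ s`) sum to `0`. -/
theorem decomposable_of_twoPairs {N : ℕ} {s : Multiset (ZMod N)} (h : TwoPairs s) :
    ∃ a b : ZMod N, a ::ₘ b ::ₘ 0 ≤ s ∧ a + b = 0 := by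
  obtain ⟨a, b, rfl⟩ := h
  refine ⟨a, -a, ?_, add_neg_cancel a⟩
  exact Multiset.cons_le_cons a (Multiset.cons_le_cons (-a) (Multiset.zero_le _))

/-- a sum of two pairs at an odd level, read back: it IS a Hodge multiset (so `B2` is an `iff`-shaped
classification of the 4-element Hodge multisets at these levels, the pairs being Hodge [Shioda]). -/
theorem twoPairs_card {N : ℕ} {s : Multiset (ZMod N)} (h : TwoPairs s) : Multiset.card s = 4 := by
  obtain ⟨a, b, rfl⟩ := h
  simp

/-- Shioda's `σ₃`-type quadruple `{1, 6, 11, 12}` of level `15 = 3 · 5` is a Hodge multiset … -/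
example : IsHodgeMultiset ({1, 6, 11, 12} : Multiset (ZMod 15)) := by
  unfold IsHodgeMultiset mNormSum
  decide

/-- … and is NOT a sum of two pairs: the hypothesis `3 ∤ N` of `B2` cannot be dropped. -/
example : ¬ TwoPairs ({1, 6, 11, 12} : Multiset (ZMod 15)) := by
  unfold TwoPairs
  decide

end HodgeFermat.KRFree.TheoremB2

-- ════════════════════════════════════════════════════════════════════════════════════════════════
-- module 2/2: HodgeFermat/TheoremB2Final.lean (source lines 23–27, 32–46)
-- ════════════════════════════════════════════════════════════════════════════════════════════════

set_option autoImplicit false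

namespace HodgeFermat.KRFree.TheoremB2

open Literature.AlgebraicGeometry.HodgeTheory.FermatCharacter (IsHodgeMultiset)
open HodgeFermat.KRFree.TheoremKR renaming KR6Multiset → KR6Multiset', kr6Multiset → kr6Multiset'

-- `theorem kr6Multiset' : KR6Multiset' := TheoremKR.kr6Multiset` (source l.29–30): NOT re-declared — it is, statement and
-- content, the landed THEOREM KR6 in multiset form `HodgeFermat.KRFree.TheoremKR.kr6Multiset` (`HodgeFermatPropDPrimeNFinal.lean`),
-- renamed into scope above (DEDUP).

/-- **THEOREM B2** (no binders): Aoki–Shioda's `(𝔅²_N)(i)` at every squarefree level `N` prime to `6`, in the kernel. -/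
theorem b2 : B2 := b2_of_kr6 kr6Multiset'

/-- the level-`N` statement, spelled out. -/
theorem b2At (N : ℕ) (hsq : Squarefree N) (h2 : ¬ 2 ∣ N) (h3 : ¬ 3 ∣ N)
    (s : Multiset (ZMod N)) (hs : IsHodgeMultiset s) (h4 : Multiset.card s = 4) : TwoPairs s :=
  b2 N hsq h2 h3 s hs h4

/-- Aoki–Shioda's wording: some two entries of a Hodge quadruple of squarefree level prime to `6` sum to `0`. -/
theorem decomposableAt (N : ℕ) (hsq : Squarefree N) (h2 : ¬ 2 ∣ N) (h3 : ¬ 3 ∣ N)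
    (s : Multiset (ZMod N)) (hs : IsHodgeMultiset s) (h4 : Multiset.card s = 4) :
    ∃ a b : ZMod N, a ::ₘ b ::ₘ 0 ≤ s ∧ a + b = 0 :=
  decomposable_of_twoPairs (b2 N hsq h2 h3 s hs h4)

end HodgeFermat.KRFree.TheoremB2
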